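import Summits.Ventures.DiscreteObjects.UnitDistance.QuadraticPlanesFour
import Summits.Ventures.DiscreteObjects.UnitDistance.PlaneSqrt35Four
import Summits.Ventures.DiscreteObjects.UnitDistance.PlaneSqrt119Four
import Summits.Ventures.DiscreteObjects.UnitDistance.PlaneSqrt191Four
import Summits.Ventures.DiscreteObjects.UnitDistance.PlaneSqrt47Bounds
import HarnessLib

/-!
# Quadratic planes with chromatic number four, II: `d = 35, 119, 191`, and `χ(ℚ(√47)²) ≥ 4`
(cell `pub-namedobj`, target (U), seat udg g13 — summary)

Framing (verbatim for the cell): lottery ticket; floor = certified bounds/negative ranges.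

After udg g12's `d = 11, 23, 71` (`QuadraticPlanesFour.lean`), three more rows of the quadratic table are exact,
`χ(ℚ(√35)²) = χ(ℚ(√119)²) = χ(ℚ(√191)²) = 4`, and `χ(ℚ(√47)²) ∈ {4, 5}` (no 4-colouring of `ℚ(√47)²` is known).  Each lower bound is
an explicit triangle-free unit-distance graph with coordinates in `ℚ(√d)` that is not 3-colourable by a kernel-checked RUP certificate
(`W₃₅`: 481 vertices, `W₄₇`: 171, `W₁₁₉`: 180, `W₁₉₁`: 76).  With `d = 35` the table of square-free `d ≤ 40`
(`quadratic_table_le_40` of `QuadraticFieldsAtlas.lean`, which left `11, 23, 35` at `{3, 4}`) is decided completely: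
`quadratic_table_le_40_exact`.  The witnesses were found by searching balls of the Cayley graph of `ℚ(√d)²` on the denominators of its
SHORTEST ODD UNIT CYCLES (unit 5-cycles for `35, 119, 191`, a 7-cycle for `47`; `code/udg13/`).  Values not found in print (PROVISIONAL).
-/

noncomputable section

namespace Summit.Ventures.DiscreteObjects.UnitDistance

open SimpleGraph IntermediateField
open scoped IntermediateField

/-- THREE MORE EXACT QUADRATIC ROWS: `χ(ℚ(√35)²) = χ(ℚ(√119)²) = χ(ℚ(√191)²) = 4`. -/
theorem chromaticNumber_plane_sqrt_35_119_191 :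
    (planeUnitDistanceGraph.induce (fieldPoints ℚ⟮Real.sqrt 35⟯)).chromaticNumber = 4 ∧
    (planeUnitDistanceGraph.induce (fieldPoints ℚ⟮Real.sqrt 119⟯)).chromaticNumber = 4 ∧
    (planeUnitDistanceGraph.induce (fieldPoints ℚ⟮Real.sqrt 191⟯)).chromaticNumber = 4 :=
  ⟨chromaticNumber_plane_sqrt35, chromaticNumber_plane_sqrt119, chromaticNumber_plane_sqrt191⟩

/-- The six exact rows with value four known in the tree (udg g12: `11, 23, 71`; udg g13: `35, 119, 191`), atlas vocabulary. -/
theorem chromaticNumber_plane_multiSqrtField_eq_four :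
    ∀ d ∈ ({11, 23, 35, 71, 119, 191} : Finset ℕ),
      (planeUnitDistanceGraph.induce (fieldPoints (multiSqrtField {d}))).chromaticNumber = 4 := by
  intro d hd
  simp only [Finset.mem_insert, Finset.mem_singleton] at hd
  rcases hd with rfl | rfl | rfl | rfl | rfl | rfl
  · exact chromaticNumber_plane_multiSqrtField_11
  · exact chromaticNumber_plane_multiSqrtField_23
  · exact chromaticNumber_plane_multiSqrtField_35
  · exact chromaticNumber_plane_multiSqrtField_71
  · exact chromaticNumber_plane_multiSqrtField_119
  · exact chromaticNumber_plane_multiSqrtField_191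

/-- THE QUADRATIC TABLE FOR SQUARE-FREE `d ≤ 40` IS EXACT: `χ(ℚ(√d)²) = 2` for the sixteen `d ≢ 3 (mod 4)`, `= 3` for
`d ∈ {3, 7, 15, 19, 31, 39}`, `= 4` for `d ∈ {11, 23, 35}` (the `2`/`3` parts are `quadratic_table_le_40`). -/
theorem quadratic_table_le_40_exact :
    (∀ d ∈ ({2, 5, 6, 10, 13, 14, 17, 21, 22, 26, 29, 30, 33, 34, 37, 38} : Finset ℕ),
        (planeUnitDistanceGraph.induce (fieldPoints (multiSqrtField {d}))).chromaticNumber = 2) ∧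
    (∀ d ∈ ({3, 7, 15, 19, 31, 39} : Finset ℕ),
        (planeUnitDistanceGraph.induce (fieldPoints (multiSqrtField {d}))).chromaticNumber = 3) ∧
    (∀ d ∈ ({11, 23, 35} : Finset ℕ),
        (planeUnitDistanceGraph.induce (fieldPoints (multiSqrtField {d}))).chromaticNumber = 4) := by
  refine ⟨quadratic_table_le_40.1, quadratic_table_le_40.2.1, ?_⟩
  intro d hd
  simp only [Finset.mem_insert, Finset.mem_singleton] at hd
  rcases hd with rfl | rfl | rfl
  · exact chromaticNumber_plane_multiSqrtField_11
  · exact chromaticNumber_plane_multiSqrtField_23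
  · exact chromaticNumber_plane_multiSqrtField_35

/- `d = 47`: `4 ≤ χ(ℚ(√47)²) ≤ 5` is `chromaticNumber_plane_sqrt47_bounds` (`PlaneSqrt47Bounds.lean`) — the first quadratic row whose
   lower bound exceeds every colouring the tree knows (`47 ≡ 7 (mod 8)`, `≡ 2 (mod 3)`, a non-residue mod `7`). -/

/-- The four witnesses are triangle-free and not 3-colourable (so each is a triangle-free 4-chromatic unit-distance graph:
`χ(W) = 4` for `W₃₅, W₄₇, W₁₁₉, W₁₉₁` is in the respective files). -/
theorem witnessesB_triangleFree_not_three_colourable :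
    (w35Graph.CliqueFree 3 ∧ ¬ w35Graph.Colorable 3) ∧ (w47Graph.CliqueFree 3 ∧ ¬ w47Graph.Colorable 3) ∧
    (w119Graph.CliqueFree 3 ∧ ¬ w119Graph.Colorable 3) ∧ (w191Graph.CliqueFree 3 ∧ ¬ w191Graph.Colorable 3) := by
  have h141 : Irrational (Real.sqrt ((141 : ℕ) : ℝ)) :=
    irrational_sqrt_natCast_iff.2 (not_isSquare_of_between (r := 11) (by norm_num) (by norm_num))
  have h119 : Irrational (Real.sqrt ((119 : ℕ) : ℝ)) :=
    irrational_sqrt_natCast_iff.2 (not_isSquare_of_between (r := 10) (by norm_num) (by norm_num))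
  have h357 : Irrational (Real.sqrt ((357 : ℕ) : ℝ)) :=
    irrational_sqrt_natCast_iff.2 (not_isSquare_of_between (r := 18) (by norm_num) (by norm_num))
  have h573 : Irrational (Real.sqrt ((573 : ℕ) : ℝ)) :=
    irrational_sqrt_natCast_iff.2 (not_isSquare_of_between (r := 23) (by norm_num) (by norm_num))
  have h47 := sqrt3_not_mem_adjoin_sqrt 47 (by norm_num : Nat.Prime 47).irrational_sqrt
    (by convert h141 using 2; push_cast; norm_num)
  have h119' := sqrt3_not_mem_adjoin_sqrt 119 h119 (by convert h357 using 2; push_cast; norm_num)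
  have h191 := sqrt3_not_mem_adjoin_sqrt 191 (by norm_num : Nat.Prime 191).irrational_sqrt
    (by convert h573 using 2; push_cast; norm_num)
  rw [Nat.cast_ofNat] at h47 h119' h191
  have tf : ∀ {n : ℕ} {W : SimpleGraph (Fin n)} (K : IntermediateField ℚ ℝ),
      (planeUnitDistanceGraph.induce (fieldPoints K)).CliqueFree 3 →
      (W →g planeUnitDistanceGraph.induce (fieldPoints K)) → W.CliqueFree 3 := by
    intro n W K hK f s hs
    rw [is3Clique_iff] at hs
    obtain ⟨a, b, c, hab, hac, hbc, -⟩ := hs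
    exact hK _ (is3Clique_triple_iff.2 ⟨f.map_rel hab, f.map_rel hac, f.map_rel hbc⟩)
  exact ⟨⟨tf _ cliqueFree_three_plane_sqrt_7_23_35.2.2 w35Hom, not_colorable_three_w35Graph⟩,
    ⟨tf _ (cliqueFree_three_plane_of_sqrt3_not_mem _ h47) w47Hom, not_colorable_three_w47Graph⟩,
    ⟨tf _ (cliqueFree_three_plane_of_sqrt3_not_mem _ h119') w119Hom, not_colorable_three_w119Graph⟩,
    ⟨tf _ (cliqueFree_three_plane_of_sqrt3_not_mem _ h191) w191Hom, not_colorable_three_w191Graph⟩⟩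

end Summit.Ventures.DiscreteObjects.UnitDistance
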